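import Literature.Analysis.FluidPDE.PassiveVectorTensorDistortedDuality
import HarnessLib

/-!
# The distorted weak class paired with FRAME-CORRECTED tests: the space–time pairing identity for
# `Ψ = J • φ` with `G J = 1`

Analysis/FluidPDE proof-support file (everything proved; no definitions, no named facts) over the
`G`-distorted weak class `Torus.IsWeakTensorPassiveVectorDistortedOn A T 𝔸 b G w₀ w`
(`PassiveVectorTensorDistorted.lean`) and its space–time pairing identity
(`PassiveVectorTensorDistortedDuality.lean` §2, `ae_integral_inner_lipschitzField_eq`).

The admissible tests of the distorted class must satisfy the DISTORTED constraint `∇·(G(t)Ψ(t)) = 0`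
for every `t`.  When the distortion has a pointwise inverse `J(t,y)` (`G J = 1`; for the
Lagrangian-coordinate class `G = (∇X)⁻¹`, `J = ∇X`), the admissible tests are exactly the
FRAME-CORRECTED fields `Ψ = J • φ` with `φ` (flat-)divergence free (`distort_mul_distort`,
`distort G (distort J φ) = φ`).  This file records:
* `distort_mul_distort`, `distort_sub_field`, `hasDerivAt_distort` — the algebra and the product rule
  `∂_t (J • φ) = J′ • φ + J • φ′` at a point (entrywise/coordinatewise `HasDerivAt`);
* **`IsWeakTensorPassiveVectorDistortedOn.ae_integral_inner_distort_frame_eq`** — the space–time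
  pairing identity for `Ψ = J • φ`: for a.e. `t ∈ (0,T)`,
  `∫⟪w t, J t • φ t⟫ = ∫⟪w₀, J 0 • φ 0⟫ + ∫_{(0,t]}∫ (⟪w, J′•φ + J•φ′ + (b·∇)(J•φ) + 𝓛^{G,*}_𝔸 (J•φ)⟫ + A⟪b, (w·∇)(J•φ)⟫)`
  (the regularity of the product field — smooth slices, jointly continuous iterated space
  derivatives, time-Lipschitz on `[0,T]` — and the integrability of the space–time integrand are
  hypotheses, discharged by the frame-regularity package of the flow and the modal adjoint fields in
  the consumer), and its form `…_of_frame_zero` when `J 0 = 1` (frame started at the window's left end: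
  the datum term is `∫⟪w₀, φ 0⟫`).
This is the a.e. (du Bois-Reymond) form of the weak formulation of DiPerna–Lions (1989, §II.1
(13)–(14)) / Temam (1997, Ch. II §3, (3.2)–(3.5)) for the Lagrangian-coordinate problem, written for
the natural pull-back test fields.

Consumer: cell `ad-ideate`, K1L_D `stmt-AnomalousDissipation-27980`, S23‴ sub-stubs at frame level
(W3a/W3c modal tracking, companions W5, (V_G) W6; tenure D25-3): with `J = frameJac E m (w+·) w`
(ad-lit FR package `TorusFlowFrameRegularity`) and `φ` a modal adjoint field
(`PassiveVectorTensorModalAdjointField`), this identity is (ID) of the W3 finding memo.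

## Mathlib / tree search
Tree: `Torus.distort` (+ `distort_apply/one/add/smul`), `IsWeakTensorPassiveVectorDistortedOn.ae_integral_inner_lipschitzField_eq`
(DistortedDuality §2); no product-test form existed (`rg "distort (J" Literature`: none).  Mathlib:
`hasDerivAt_pi`, `HasDerivAt.sum/mul`, `PiLp.hasDerivAt_iff`-type coordinate reduction via `WithLp`.

## References
* R. J. DiPerna, P.-L. Lions, Invent. Math. 98 (1989), §II.1 (13)–(14). [`DiPernaLions1989`]
* R. Temam, *Infinite-Dimensional Dynamical Systems in Mechanics and Physics*, 2nd ed. (Springer 1997),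
  Ch. II §3.1–3.2, (3.2)–(3.5), Thm. 3.1. [`Temam1997`]
* S. Armstrong, V. Vicol, arXiv:2305.05048, §4.1 (Lagrangian coordinates, the distortion `∇X⁻¹`). [`ArmstrongVicol2025`]
-/

noncomputable section

open MeasureTheory Set Filter Function
open scoped ENNReal NNReal InnerProductSpace

namespace Literature.Analysis.FluidPDE

namespace Torus

variable {d : Type*} [Fintype d] [DecidableEq d]

/-! ## §1 Algebra and the pointwise product rule for distorted fields -/

omit [DecidableEq d] in
/-- Composition of distortions is the distortion by the matrix product: `G • (J • v) = (G J) • v`.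
[cite: ArmstrongVicol2025, §4.1 (s_{m−1}, T_{m−1}), PDF p. 34] -/
theorem distort_mul_distort (G J : UnitAddTorus d → Matrix d d ℝ) (v : UnitAddTorus d → EuclideanSpace ℝ d) :
    distort G (distort J v) = distort (fun y => G y * J y) v := by
  funext y
  simp only [distort, WithLp.ofLp_toLp, Matrix.mulVec_mulVec]

/-- A pointwise inverse frame undoes the distortion: `G J = 1 ⇒ G • (J • v) = v`.
[cite: ArmstrongVicol2025, §4.1 (s_{m−1}, T_{m−1}), PDF p. 34] -/
theorem distort_distort_of_mul_eq_one {G J : UnitAddTorus d → Matrix d d ℝ} (hGJ : ∀ y, G y * J y = 1)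
    (v : UnitAddTorus d → EuclideanSpace ℝ d) : distort G (distort J v) = v := by
  rw [distort_mul_distort]
  have e : (fun y => G y * J y) = fun _ => (1 : Matrix d d ℝ) := funext hGJ
  rw [e, distort_one]

omit [DecidableEq d] in
/-- `distort` is additive in the matrix field. [cite: ArmstrongVicol2025, §4.1 (s_{m−1}, T_{m−1}), PDF p. 34] -/
theorem distort_add_matrix (G H : UnitAddTorus d → Matrix d d ℝ) (v : UnitAddTorus d → EuclideanSpace ℝ d) :
    distort (fun y => G y + H y) v = distort G v + distort H v := by
  funext y
  simp only [distort, Matrix.add_mulVec, WithLp.toLp_add, Pi.add_apply]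

omit [DecidableEq d] in
/-- **Product rule for distorted fields at a point**: if `s ↦ J s y` and `s ↦ φ s y` are differentiable at
`t` then `s ↦ (J s • φ s) y` is, with derivative `(J′ • φ t + J t • φ′) y`.
[cite: Temam1997, Ch. II §3.1–3.2, (3.2)–(3.5), Thm. 3.1] -/
theorem hasDerivAt_distort {J : ℝ → UnitAddTorus d → Matrix d d ℝ} {φ : ℝ → UnitAddTorus d → EuclideanSpace ℝ d}
    {J' : UnitAddTorus d → Matrix d d ℝ} {φ' : UnitAddTorus d → EuclideanSpace ℝ d} {t : ℝ} {y : UnitAddTorus d}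
    (hJ : HasDerivAt (fun s => J s y) (J' y) t) (hφ : HasDerivAt (fun s => φ s y) (φ' y) t) :
    HasDerivAt (fun s => distort (J s) (φ s) y) (distort J' (φ t) y + distort (J t) φ' y) t := by
  -- coordinates
  have hφc : ∀ a, HasDerivAt (fun s => φ s y a) (φ' y a) t := fun a =>
    ((EuclideanSpace.proj a : EuclideanSpace ℝ d →L[ℝ] ℝ).hasFDerivAt).comp_hasDerivAt t hφ
  have hJca : ∀ c a, HasDerivAt (fun s => J s y c a) (J' y c a) t := fun c a =>
    (hasDerivAt_pi.1 ((hasDerivAt_pi.1 hJ) c)) a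
  -- the underlying `d → ℝ` curve
  have hf : HasDerivAt (fun s => (J s y).mulVec (WithLp.ofLp (φ s y)))
      ((J' y).mulVec (WithLp.ofLp (φ t y)) + (J t y).mulVec (WithLp.ofLp (φ' y))) t := by
    rw [hasDerivAt_pi]
    intro c
    have hsum := HasDerivAt.sum (u := Finset.univ) (A := fun a s => J s y c a * φ s y a)
      (A' := fun a => J' y c a * φ t y a + J t y c a * φ' y a) (x := t) (fun a _ => (hJca c a).mul (hφc a))
    have e1 : (fun s => (J s y).mulVec (WithLp.ofLp (φ s y)) c) = fun s => ∑ a ∈ Finset.univ, J s y c a * φ s y a := by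
      funext s; simp [Matrix.mulVec, dotProduct]
    have e2 : ((J' y).mulVec (WithLp.ofLp (φ t y)) + (J t y).mulVec (WithLp.ofLp (φ' y))) c =
        ∑ a ∈ Finset.univ, (J' y c a * φ t y a + J t y c a * φ' y a) := by
      simp [Matrix.mulVec, dotProduct, Finset.sum_add_distrib]
    rw [e1, e2]
    have e5 : (fun s => ∑ a ∈ Finset.univ, J s y c a * φ s y a) = ∑ a ∈ Finset.univ, fun s => J s y c a * φ s y a := by
      funext s; simp [Finset.sum_apply]
    rw [e5]
    exact hsum
  have h2 := ((PiLp.continuousLinearEquiv 2 ℝ (fun _ : d => ℝ)).symm.toContinuousLinearMap.hasFDerivAt).comp_hasDerivAt t hf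
  have e3 : (⇑(PiLp.continuousLinearEquiv 2 ℝ (fun _ : d => ℝ)).symm.toContinuousLinearMap ∘
      fun s => (J s y).mulVec (WithLp.ofLp (φ s y))) = fun s => distort (J s) (φ s) y := by
    funext s; rfl
  have e4 : (PiLp.continuousLinearEquiv 2 ℝ (fun _ : d => ℝ)).symm.toContinuousLinearMap
      ((J' y).mulVec (WithLp.ofLp (φ t y)) + (J t y).mulVec (WithLp.ofLp (φ' y))) =
      distort J' (φ t) y + distort (J t) φ' y := by
    rw [map_add]; rfl
  rw [e3, e4] at h2
  exact h2

/-! ## §2 The pairing identity for frame-corrected tests `Ψ = J • φ` -/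

namespace IsWeakTensorPassiveVectorDistortedOn

variable {A T : ℝ} {𝔸 : Visc4 d} {b w : ℝ → UnitAddTorus d → EuclideanSpace ℝ d}
  {G : ℝ → UnitAddTorus d → Matrix d d ℝ} {w₀ : UnitAddTorus d → EuclideanSpace ℝ d}

/-- **The space–time pairing identity of the distorted class for a FRAME-CORRECTED test `Ψ = J • φ`.**
Let `G J = 1` pointwise, `φ` be (flat-)divergence free at every time, and let `J, φ` have time derivatives
`J′, φ′` at every point for a.e. `t ∈ (0,T)`; assume the product field `t ↦ J t • φ t` is a time-Lipschitz
space-smooth field on `[0,T]` (smooth slices, all iterated space derivatives jointly continuous, Lipschitz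
in `t` uniformly in `y`) and the space–time integrand below is integrable.  Then for a.e. `t ∈ (0,T)`:
`∫⟪w t, J t • φ t⟫ = ∫⟪w₀, J 0 • φ 0⟫ + ∫_{(0,t]}∫ (⟪w, J′•φ + J•φ′ + (b·∇)(J•φ) + 𝓛^{G,*}_𝔸(J•φ)⟫ + A⟪b, (w·∇)(J•φ)⟫)`.
[cite: DiPernaLions1989, §II.1 (13)–(14)] [cite: Temam1997, Ch. II §3.1–3.2, (3.2)–(3.5), Thm. 3.1] -/
theorem ae_integral_inner_distort_frame_eq (h : IsWeakTensorPassiveVectorDistortedOn A T 𝔸 b G w₀ w)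
    {J J' : ℝ → UnitAddTorus d → Matrix d d ℝ} {φ φ' : ℝ → UnitAddTorus d → EuclideanSpace ℝ d}
    (hΨs : ∀ t, FunctionSpaces.Torus.IsSmooth (distort (J t) (φ t)))
    (hΨc : ∀ l : List d, Continuous (uncurry fun t y => FunctionSpaces.Torus.iterPartialDeriv l (distort (J t) (φ t)) y))
    (hΨL : ∃ L : ℝ, 0 ≤ L ∧ ∀ t ∈ Icc 0 T, ∀ s ∈ Icc 0 T, ∀ y,
      ‖distort (J t) (φ t) y - distort (J s) (φ s) y‖ ≤ L * |t - s|)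
    (hGJ : ∀ t y, G t y * J t y = 1)
    (hφdiv : ∀ t, FunctionSpaces.Torus.IsDivFree (φ t))
    (hJ' : ∀ᵐ t ∂(volume.restrict (Ioo 0 T)), ∀ y, HasDerivAt (fun s => J s y) (J' t y) t)
    (hφ' : ∀ᵐ t ∂(volume.restrict (Ioo 0 T)), ∀ y, HasDerivAt (fun s => φ s y) (φ' t y) t)
    (hint : Integrable (fun p : ℝ × UnitAddTorus d =>
      ⟪w p.1 p.2, (distort (J' p.1) (φ p.1) p.2 + distort (J p.1) (φ' p.1) p.2) +
          FunctionSpaces.Torus.convect (b p.1) (distort (J p.1) (φ p.1)) p.2 +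
          viscAdjVar (fun y => Visc4.conj (G p.1 y) 𝔸) (distort (J p.1) (φ p.1)) p.2⟫_ℝ +
        A * ⟪b p.1 p.2, FunctionSpaces.Torus.convect (w p.1) (distort (J p.1) (φ p.1)) p.2⟫_ℝ)
      (((volume : Measure ℝ).restrict (Ioo 0 T)).prod volume)) :
    ∀ᵐ t ∂(volume.restrict (Ioo 0 T)),
      ∫ x, ⟪w t x, distort (J t) (φ t) x⟫_ℝ = (∫ x, ⟪w₀ x, distort (J 0) (φ 0) x⟫_ℝ) +
        ∫ τ in Ioc 0 t, ∫ x, (⟪w τ x, (distort (J' τ) (φ τ) x + distort (J τ) (φ' τ) x) +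
            FunctionSpaces.Torus.convect (b τ) (distort (J τ) (φ τ)) x +
            viscAdjVar (fun y => Visc4.conj (G τ y) 𝔸) (distort (J τ) (φ τ)) x⟫_ℝ +
          A * ⟪b τ x, FunctionSpaces.Torus.convect (w τ) (distort (J τ) (φ τ)) x⟫_ℝ) := by
  -- the distorted constraint holds for every `t`: `G • (J • φ) = φ` is divergence free
  have hΨdiv : ∀ t, FunctionSpaces.Torus.IsDivFree (distort (G t) (distort (J t) (φ t))) := fun t => by
    rw [distort_distort_of_mul_eq_one (hGJ t)]
    exact hφdiv t
  -- the time derivative of the product field, a.e. `t`, every `y`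
  have hΨ' : ∀ᵐ t ∂(volume.restrict (Ioo 0 T)), ∀ y,
      HasDerivAt (fun s => distort (J s) (φ s) y) (distort (J' t) (φ t) y + distort (J t) (φ' t) y) t := by
    filter_upwards [hJ', hφ'] with t htJ htφ y
    exact hasDerivAt_distort (htJ y) (htφ y)
  exact h.ae_integral_inner_lipschitzField_eq (ψ := fun t => distort (J t) (φ t))
    (ψ' := fun t y => distort (J' t) (φ t) y + distort (J t) (φ' t) y) hΨs hΨc hΨL hΨdiv hΨ' hint

/-- **The same identity for a frame started at the window's left end** (`J 0 = 1`): the datum term is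
`∫⟪w₀, φ 0⟫`. [cite: DiPernaLions1989, §II.1 (13)–(14)] [cite: Temam1997, Ch. II §3.1–3.2, (3.2)–(3.5), Thm. 3.1] -/
theorem ae_integral_inner_distort_frame_eq_of_frame_zero (h : IsWeakTensorPassiveVectorDistortedOn A T 𝔸 b G w₀ w)
    {J J' : ℝ → UnitAddTorus d → Matrix d d ℝ} {φ φ' : ℝ → UnitAddTorus d → EuclideanSpace ℝ d}
    (hΨs : ∀ t, FunctionSpaces.Torus.IsSmooth (distort (J t) (φ t)))
    (hΨc : ∀ l : List d, Continuous (uncurry fun t y => FunctionSpaces.Torus.iterPartialDeriv l (distort (J t) (φ t)) y))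
    (hΨL : ∃ L : ℝ, 0 ≤ L ∧ ∀ t ∈ Icc 0 T, ∀ s ∈ Icc 0 T, ∀ y,
      ‖distort (J t) (φ t) y - distort (J s) (φ s) y‖ ≤ L * |t - s|)
    (hGJ : ∀ t y, G t y * J t y = 1) (hJ0 : ∀ y, J 0 y = 1)
    (hφdiv : ∀ t, FunctionSpaces.Torus.IsDivFree (φ t))
    (hJ' : ∀ᵐ t ∂(volume.restrict (Ioo 0 T)), ∀ y, HasDerivAt (fun s => J s y) (J' t y) t)
    (hφ' : ∀ᵐ t ∂(volume.restrict (Ioo 0 T)), ∀ y, HasDerivAt (fun s => φ s y) (φ' t y) t)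
    (hint : Integrable (fun p : ℝ × UnitAddTorus d =>
      ⟪w p.1 p.2, (distort (J' p.1) (φ p.1) p.2 + distort (J p.1) (φ' p.1) p.2) +
          FunctionSpaces.Torus.convect (b p.1) (distort (J p.1) (φ p.1)) p.2 +
          viscAdjVar (fun y => Visc4.conj (G p.1 y) 𝔸) (distort (J p.1) (φ p.1)) p.2⟫_ℝ +
        A * ⟪b p.1 p.2, FunctionSpaces.Torus.convect (w p.1) (distort (J p.1) (φ p.1)) p.2⟫_ℝ)
      (((volume : Measure ℝ).restrict (Ioo 0 T)).prod volume)) :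
    ∀ᵐ t ∂(volume.restrict (Ioo 0 T)),
      ∫ x, ⟪w t x, distort (J t) (φ t) x⟫_ℝ = (∫ x, ⟪w₀ x, φ 0 x⟫_ℝ) +
        ∫ τ in Ioc 0 t, ∫ x, (⟪w τ x, (distort (J' τ) (φ τ) x + distort (J τ) (φ' τ) x) +
            FunctionSpaces.Torus.convect (b τ) (distort (J τ) (φ τ)) x +
            viscAdjVar (fun y => Visc4.conj (G τ y) 𝔸) (distort (J τ) (φ τ)) x⟫_ℝ +
          A * ⟪b τ x, FunctionSpaces.Torus.convect (w τ) (distort (J τ) (φ τ)) x⟫_ℝ) := by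
  have hJ0' : J 0 = fun _ => (1 : Matrix d d ℝ) := funext hJ0
  have e : distort (J 0) (φ 0) = φ 0 := by rw [hJ0', distort_one]
  have hmain := h.ae_integral_inner_distort_frame_eq hΨs hΨc hΨL hGJ hφdiv hJ' hφ' hint
  rw [e] at hmain
  exact hmain

end IsWeakTensorPassiveVectorDistortedOn

end Torus

end Literature.Analysis.FluidPDE

end
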